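import Mathlib.Data.Real.Basic
import Mathlib.Tactic.Linarith
import Mathlib.Tactic.Ring
import Mathlib.Tactic.Positivity
import HarnessLib

/-!
# `NoHeavyLowerTail` (stmt-CriticalPhenomena-4575) — the one-coordinate arithmetic of the CUBIC sunflower
# inequality (lattice AG⁺ = CSH₃) and its consequences AG⁺ ⟹ SHK3⁺

Support file (new-inequality factory, all-graph proof seat `prim-ineq-prove-4` gen 2; `--supports
stmt-CriticalPhenomena-4575`).  No definitions, no named facts, no sorries; pure real arithmetic.

Setting (memo `run/shared/lean/prim/prim-ineq-prove-4/MEMO-AGPLUS-LATTICE.md`).  For a three-petal sunflower of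
up-sets in a finite product space (core mass `t`, petal masses `u₁ u₂ u₃`, outside mass `q`; cf. the tree's
`Literature.Probability.LatticeModels.prodBernoulli_strongHarris_sunflower_three`, which is Gladkov's `t q ≥ e₂(u)`), the
conjectured cubic strengthening ("lattice AG⁺", prove-2's CSH₃) is `t q ≥ e₂(u) + e₃(u)`; its percolation instance is the
three-point inequality AG⁺ and, with Gladkov's AG, the Richards–Sahi form SHK3⁺ `(1+t)(qt − e₂) − e₃ ≥ 0` of the bern4
programme.  Gladkov's proof of the quadratic inequality is an induction on coordinates; this file isolates the exact algebra of
that induction step for the cubic functional, in the variables of the refined (twelve-type) slice system of one coordinate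
with parameter `p`:

* masses `a₀` (core in both slices), `b₀` (outside in both), `d` (outside → core), and for each petal `i` the masses
  `cp i` (petal → core), `co i` (petal in both slices), `cm i` (outside → petal);
* slice laws: core `a₀` / `a₁ = a₀ + d + Σ cp`, outside `q₀ = b₀ + d + Σ cm` / `q₁ = b₀`, petals `x i = co i + cp i` /
  `y i = co i + cm i`; the law at parameter `p` is the convex combination with weights `1 − p`, `p`.

Results (all PROVED, elementary):
* `SunflowerCubicStep.step_identity` — with `Φ(t,u,q) := t q − e₂(u) − e₃(u)`,
  `Φ(law p) = (1−p) Φ(slice 0) + p Φ(slice 1) + p(1−p)·L`, where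
  `L = α β + Σ_{i<j} (1 + u_m(p)) δ_i δ_j + (1 − 2p) δ₁ δ₂ δ₃`, `α = d + Σ cp`, `β = d + Σ cm`, `δ_i = cm i − cp i`
  (`u_m(p)` the petal mass of the mixed law) — the cubic analogue of the concavity term in Gladkov's proof;
* `SunflowerCubicStep.step_of_good` — if both slices satisfy `Φ ≥ 0` and `L ≥ 0` ("the coordinate is good") then
  `Φ(law p) ≥ 0` for `p ∈ [0,1]`;
* `SunflowerCubicStep.good_of_sameSign_nonneg` / `_nonpos` — a coordinate at which the three signed influences `δ_i`
  have the same sign is good (`L ≥ 0`), for masses in `[0,1]`;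
* `SunflowerCubicStep.agPlus_of_h3`, `SunflowerCubicStep.shk3plus_of_agPlus` — the elementary implications
  `(tq − e₂)(t+q) ≥ e₃ ∧ tq ≥ e₂ ∧ t+q ≤ 1 ⟹ tq ≥ e₂ + e₃` and `tq ≥ e₂ + e₃ ∧ tq ≥ e₂ ∧ t ≥ 0 ⟹ (1+t)(qt−e₂) − e₃ ≥ 0`.
What is NOT here: the existence of a good coordinate (memo §4: holds in 1 813/1 813 sampled systems for the coordinate
maximising `α β + e₂(δ)`; the averaged form `Σ_e p_e(1−p_e) L_e ≥ 0` in 1 779/1 779) — that is the open combinatorial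
statement which, with this file and the induction shell of `StrongHarris.core`, would prove lattice AG⁺, AG⁺ and SHK3⁺.
-/

namespace Summit.CriticalPhenomena.PercolationContinuityZ3.Theorems

namespace SunflowerCubicStep

/-- The cubic sunflower functional `Φ(t; u₁,u₂,u₃; q) = t q − e₂(u) − e₃(u)` ("lattice AG⁺ slack"). [this file] -/
theorem phi_def (t u₁ u₂ u₃ q : ℝ) :
    t * q - (u₁ * u₂ + u₁ * u₃ + u₂ * u₃) - u₁ * u₂ * u₃ =
      t * q - (u₁ * u₂ + u₁ * u₃ + u₂ * u₃) - u₁ * u₂ * u₃ := rfl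

/-- **One-coordinate identity for the cubic sunflower functional.**  In the refined-slice variables (see the module
docstring), with `pb = 1 − p`:
`Φ(law p) = pb·Φ(slice 0) + p·Φ(slice 1) + pb·p·[αβ + Σ_{i<j}(1+u_m)δ_iδ_j + (1−2p)δ₁δ₂δ₃]`.
[cite: Gladkov2024StrongFKG, proof of Thm. 2.1 (the quadratic part `αβ + e₂(δ)`); this file (cubic terms)] -/
theorem step_identity (p a₀ b₀ d cp₁ cp₂ cp₃ co₁ co₂ co₃ cm₁ cm₂ cm₃ : ℝ) :
    let pb := 1 - p
    let a₁ := a₀ + d + (cp₁ + cp₂ + cp₃)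
    let q₀ := b₀ + d + (cm₁ + cm₂ + cm₃)
    let q₁ := b₀
    let x₁ := co₁ + cp₁
    let x₂ := co₂ + cp₂
    let x₃ := co₃ + cp₃
    let y₁ := co₁ + cm₁
    let y₂ := co₂ + cm₂
    let y₃ := co₃ + cm₃
    let t := pb * a₀ + p * a₁
    let q := pb * q₀ + p * q₁
    let u₁ := pb * x₁ + p * y₁
    let u₂ := pb * x₂ + p * y₂
    let u₃ := pb * x₃ + p * y₃
    let α := d + (cp₁ + cp₂ + cp₃)
    let β := d + (cm₁ + cm₂ + cm₃)
    let δ₁ := cm₁ - cp₁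
    let δ₂ := cm₂ - cp₂
    let δ₃ := cm₃ - cp₃
    t * q - (u₁ * u₂ + u₁ * u₃ + u₂ * u₃) - u₁ * u₂ * u₃ =
      pb * (a₀ * q₀ - (x₁ * x₂ + x₁ * x₃ + x₂ * x₃) - x₁ * x₂ * x₃) +
        p * (a₁ * q₁ - (y₁ * y₂ + y₁ * y₃ + y₂ * y₃) - y₁ * y₂ * y₃) +
        pb * p * (α * β + ((1 + u₃) * (δ₁ * δ₂) + (1 + u₂) * (δ₁ * δ₃) + (1 + u₁) * (δ₂ * δ₃)) +
          (1 - 2 * p) * (δ₁ * δ₂ * δ₃)) := by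
  intro pb a₁ q₀ q₁ x₁ x₂ x₃ y₁ y₂ y₃ t q u₁ u₂ u₃ α β δ₁ δ₂ δ₃
  simp only [pb, a₁, q₀, q₁, x₁, x₂, x₃, y₁, y₂, y₃, t, q, u₁, u₂, u₃, α, β, δ₁, δ₂, δ₃]
  ring

/-- **A good coordinate makes the step.**  If both slice systems satisfy the cubic inequality (`Φ₀, Φ₁ ≥ 0`, the
induction hypotheses) and the bracket `L` of `step_identity` is nonnegative, then the mixed law satisfies it for every
`p ∈ [0,1]`. [this file] -/
theorem step_of_good {p Φ₀ Φ₁ L Φ : ℝ} (hp0 : 0 ≤ p) (hp1 : p ≤ 1) (h0 : 0 ≤ Φ₀) (h1 : 0 ≤ Φ₁) (hL : 0 ≤ L)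
    (hid : Φ = (1 - p) * Φ₀ + p * Φ₁ + (1 - p) * p * L) : 0 ≤ Φ := by
  rw [hid]
  have hpb : 0 ≤ 1 - p := by linarith
  positivity

/-- `e₂(δ) ≥ 3·|e₃(δ)|`-type bound: for `δ₁, δ₂, δ₃ ∈ [0,1]`, `δ₁δ₂δ₃ ≤ δ₁δ₂` (and cyclically). [folklore] -/
theorem prod_three_le_prod_two {δ₁ δ₂ δ₃ : ℝ} (h1 : 0 ≤ δ₁) (h2 : 0 ≤ δ₂) (h3' : δ₃ ≤ 1) :
    δ₁ * δ₂ * δ₃ ≤ δ₁ * δ₂ := by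
  have h12 : 0 ≤ δ₁ * δ₂ := mul_nonneg h1 h2
  nlinarith

/-- **Same-sign influences give a good coordinate (nonnegative case).**  If the three signed influences
`δ_i = cm i − cp i` are all nonnegative (with `δ₃ ≤ 1`, automatic for masses of a probability vector), the petal
masses `u_m` are nonnegative, `αβ ≥ 0` and `p ∈ [0,1]`, then the bracket `L` of `step_identity` is nonnegative.
[this file] -/
theorem good_of_sameSign_nonneg {p α β u₁ u₂ u₃ δ₁ δ₂ δ₃ : ℝ} (hp0 : 0 ≤ p) (hp1 : p ≤ 1)
    (hαβ : 0 ≤ α * β) (hu₁ : 0 ≤ u₁) (hu₂ : 0 ≤ u₂) (hu₃ : 0 ≤ u₃)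
    (h1 : 0 ≤ δ₁) (h2 : 0 ≤ δ₂) (h3 : 0 ≤ δ₃) (h3' : δ₃ ≤ 1) :
    0 ≤ α * β + ((1 + u₃) * (δ₁ * δ₂) + (1 + u₂) * (δ₁ * δ₃) + (1 + u₁) * (δ₂ * δ₃)) +
      (1 - 2 * p) * (δ₁ * δ₂ * δ₃) := by
  have h12 : 0 ≤ δ₁ * δ₂ := mul_nonneg h1 h2
  have h13 : 0 ≤ δ₁ * δ₃ := mul_nonneg h1 h3
  have h23 : 0 ≤ δ₂ * δ₃ := mul_nonneg h2 h3
  have h123 : 0 ≤ δ₁ * δ₂ * δ₃ := mul_nonneg h12 h3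
  have hle : δ₁ * δ₂ * δ₃ ≤ δ₁ * δ₂ := prod_three_le_prod_two h1 h2 h3'
  -- the cubic correction is at most `e₂(δ)` in absolute value, and `|1 − 2p| ≤ 1`
  have hcub : -(δ₁ * δ₂) ≤ (1 - 2 * p) * (δ₁ * δ₂ * δ₃) := by nlinarith
  nlinarith [mul_nonneg hu₃ h12, mul_nonneg hu₂ h13, mul_nonneg hu₁ h23]

/-- **Same-sign influences give a good coordinate (nonpositive case).**  Mirror image of
`good_of_sameSign_nonneg` for `δ_i ≤ 0` (with `−1 ≤ δ₃`). [this file] -/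
theorem good_of_sameSign_nonpos {p α β u₁ u₂ u₃ δ₁ δ₂ δ₃ : ℝ} (hp0 : 0 ≤ p) (hp1 : p ≤ 1)
    (hαβ : 0 ≤ α * β) (hu₁ : 0 ≤ u₁) (hu₂ : 0 ≤ u₂) (hu₃ : 0 ≤ u₃)
    (h1 : δ₁ ≤ 0) (h2 : δ₂ ≤ 0) (h3 : δ₃ ≤ 0) (h3' : -1 ≤ δ₃) :
    0 ≤ α * β + ((1 + u₃) * (δ₁ * δ₂) + (1 + u₂) * (δ₁ * δ₃) + (1 + u₁) * (δ₂ * δ₃)) +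
      (1 - 2 * p) * (δ₁ * δ₂ * δ₃) := by
  -- apply the nonnegative case to `−δ` and `1 − p`
  have h := good_of_sameSign_nonneg (p := 1 - p) (α := α) (β := β) (u₁ := u₁) (u₂ := u₂) (u₃ := u₃)
    (δ₁ := -δ₁) (δ₂ := -δ₂) (δ₃ := -δ₃) (by linarith) (by linarith) hαβ hu₁ hu₂ hu₃
    (by linarith) (by linarith) (by linarith) (by linarith)
  have e : α * β + ((1 + u₃) * (-δ₁ * -δ₂) + (1 + u₂) * (-δ₁ * -δ₃) + (1 + u₁) * (-δ₂ * -δ₃)) +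
      (1 - 2 * (1 - p)) * (-δ₁ * -δ₂ * -δ₃) =
      α * β + ((1 + u₃) * (δ₁ * δ₂) + (1 + u₂) * (δ₁ * δ₃) + (1 + u₁) * (δ₂ * δ₃)) +
        (1 - 2 * p) * (δ₁ * δ₂ * δ₃) := by ring
  rw [e] at h
  exact h

/-- **H3 implies AG⁺.**  From the homogeneous cubic form `(tq − e₂)(t+q) ≥ e₃`, Gladkov's `tq ≥ e₂` and
`t + q ≤ 1` one gets `tq ≥ e₂ + e₃`. [this file] -/
theorem agPlus_of_h3 {t q e₂ e₃ : ℝ} (hH3 : e₃ ≤ (t * q - e₂) * (t + q)) (hAG : e₂ ≤ t * q)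
    (htq : t + q ≤ 1) : e₂ + e₃ ≤ t * q := by
  have hslack : 0 ≤ t * q - e₂ := by linarith
  have : (t * q - e₂) * (t + q) ≤ (t * q - e₂) * 1 := mul_le_mul_of_nonneg_left htq hslack
  linarith

/-- **AG⁺ implies SHK3⁺.**  With `tq ≥ e₂ + e₃`, Gladkov's `tq ≥ e₂` and `t ≥ 0`:
`(1 + t)(q t − e₂) − e₃ ≥ 0` (the identity `SHK3⁺ = AG⁺ + t·AG` of prim-ineq-prove-2's MEMO-7 §5). [this file] -/
theorem shk3plus_of_agPlus {t q e₂ e₃ : ℝ} (hAGp : e₂ + e₃ ≤ t * q) (hAG : e₂ ≤ t * q) (ht : 0 ≤ t) :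
    0 ≤ (1 + t) * (q * t - e₂) - e₃ := by
  have e : (1 + t) * (q * t - e₂) - e₃ = (t * q - e₂ - e₃) + t * (t * q - e₂) := by ring
  rw [e]
  have h1 : 0 ≤ t * q - e₂ - e₃ := by linarith
  have h2 : 0 ≤ t * (t * q - e₂) := mul_nonneg ht (by linarith)
  linarith

end SunflowerCubicStep

end Summit.CriticalPhenomena.PercolationContinuityZ3.Theorems
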